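import Summits.RiemannHypothesis.RiemannHypothesis.Theorems.Splittings.LiCurvatureSignChanges
import HarnessLib

/-!
# The DIFFERENCE-ORDER LAW for Li's coefficients — iterated forward differences, box sums, and the ¬RH branch at every order (SketchG7 §5, §5a)

Cell rh-split, seat rh-split-li-bridge g7 (brief sha16 f79c5f09d8bcb036), card `run/shared/lean/pub/rh-split/cards/SPLIT-li-bridge.md` §14
(referee rh-split-ref g5: REPLAY PASS of v1 353a9a80816aea0e + v2 ca059ef508c1d3b5, 08:37:53Z; labels L1–L4 there); kernel source
`HOME/rh-split-li-bridge/SketchG7.lean` sha16 dac2b83ce457a730 (1546 l; = v2 + §5e `not_tendsto_liSecondDiff/_liFdiff` + 28 one-line docstrings,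
no decl text changed).  Cut by the seat (lead RULING #60, lane (xi-g)) into SIX tree modules at the scratch's section boundaries, decl text
byte-verbatim; deltas = namespace `RhSplit.LiBridgeG7` ↦ `…Theorems.Splittings.{LiWindowComplex, LiCurvatureSignChanges, LiDifferenceOrderLaw}`
(+ `open` of the earlier namespaces of the chain), module docstrings, and the variable-free wrapper `section HigherOrder … end HigherOrder`
dropped.  END-TO-END statement of the chain (last file): `LiDifferenceOrderLaw.liFdiff_signs_syndetic (hK : 2 ≤ K) :
∃ η > 0, ∃ L, ∀ N, (∃ n ∈ Ico N (N+L), fdiff K keiperLiCoeff n ≤ −η) ∧ (∃ n ∈ Ico N (N+L), η ≤ fdiff K keiperLiCoeff n)` — every forward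
difference of order `K ≥ 2` of Li's coefficients (K = 2: the curvature `d_n = λ_{n+2} − 2λ_{n+1} + λ_n`, file `LiCurvatureSignChanges`) takes
BOTH signs with a margin on a syndetic set, UNCONDITIONALLY (proof by cases on `RiemannHypothesis`; an RH-free kernel theorem about `λ_n`
alone, referee label L1; certifies nothing about RH; class (li, bridge) unchanged).

This file: §5 preamble: `fdiff k f = Δ^k f` and its algebra (`fdiff_eq_fwdDiff_iter : fdiff k f = (fwdDiff 1)^[k] f` identifies it with Mathlib's iterated forward
difference), geometric sequences `fdiff_geom`, binomial tilt `fdiff_choose`, real parts / coercions; §5a ¬RH branch at every order `k+1 ≥ 1`: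
discrete Rolle `no_alternating_of_fdiff_nonneg`, `liFdiff_two_signs_of_not_rh (hRH : ¬RH) (k) (hη : 0 ≤ η)`, and the order-1 instance
`liIncr_two_signs_of_not_rh` (descents AND ascents of every size in every late window under ¬RH; label L3).

HONEST LABEL: «SPLITTING SEARCH over kernel-typed RH-EQUIVALENCES; a splitting A ∧ B ⟹ RH is CONDITIONAL bookkeeping unless A and B are
both proved; nothing here bears on the truth of RH.»
-/

set_option linter.dupNamespace false

noncomputable section

namespace Summit.RiemannHypothesis.RiemannHypothesis.Theorems.Splittings.LiDifferenceOrderLaw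

/-! ## §5 The DIFFERENCE-ORDER LAW: every order `K ≥ 2` is two-signed on a syndetic set, unconditionally

`fdiff K f n = (Δ^K f)(n)`.  ORDER 0: one sign for all large `n` under RH (tree `eventually_pos_of_rh`), both
signs in every late window under ¬RH (tree `li_two_signs_of_not_rh`).  ORDER 1: under RH the descents have
density zero (tree T-Li3 / lane (xi)(f) `LiIncrBlockLawOfRH.rh_iff_almostAllLiMonotone`), under ¬RH they are
eventually syndetic.  EVERY ORDER `K ≥ 2` (this section): BOTH signs, with a margin, in every window of a fixed
length, whether or not RH holds (`liFdiff_signs_syndetic`) — no one-sided sign condition on any difference of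
order `≥ 2`, on any tail or any thick set, can hold, let alone detect RH.  Under RH the coefficient mass of
`Δ^K λ` is `Σ m/|ρ|^K < ∞` exactly for `K ≥ 2`; order 1 has mass `Σ m/|ρ| = ∞`, which is where RH lives. -/

open Complex Filter Topology Finset
open scoped Real ComplexConjugate
open Literature.NumberTheory.LFunctions
open Summit.RiemannHypothesis.RiemannHypothesis.Theorems.Splittings
open Summit.RiemannHypothesis.RiemannHypothesis.Theorems.Splittings.LiIndexSets
open Summit.RiemannHypothesis.RiemannHypothesis.Theorems.Splittings.LiExtremalLayer
open Summit.RiemannHypothesis.RiemannHypothesis.Theorems.Splittings.LiSecondOrderCriterion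
open Summit.RiemannHypothesis.RiemannHypothesis.Theorems.Splittings.LiWindowComplex
open Summit.RiemannHypothesis.RiemannHypothesis.Theorems.Splittings.LiCurvatureSignChanges


/-- Iterated forward difference: `fdiff 0 f = f`, `fdiff (k+1) f = fdiff k (Δf)` with `Δf n = f (n+1) − f n`. -/
def fdiff {G : Type*} [AddCommGroup G] : ℕ → (ℕ → G) → ℕ → G
  | 0, f => f
  | k + 1, f => fdiff k (fun n ↦ f (n + 1) - f n)

section FdiffAlgebra

variable {G : Type*} [AddCommGroup G]

/-- `Δ^0 f = f`. -/
@[simp] theorem fdiff_zero (f : ℕ → G) : fdiff 0 f = f := rfl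

/-- `Δ^{k+1} f = Δ^k (Δ f)`. -/
theorem fdiff_succ (k : ℕ) (f : ℕ → G) : fdiff (k + 1) f = fdiff k (fun n ↦ f (n + 1) - f n) := rfl

/-- `(Δ f) n = f (n+1) − f n`. -/
theorem fdiff_one (f : ℕ → G) (n : ℕ) : fdiff 1 f n = f (n + 1) - f n := rfl

/-- `Δ^k` is additive. -/
theorem fdiff_add (k : ℕ) : ∀ (f g : ℕ → G) (n : ℕ),
    fdiff k (fun m ↦ f m + g m) n = fdiff k f n + fdiff k g n := by
  induction k with
  | zero => intro f g n; rfl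
  | succ k ih =>
    intro f g n
    rw [fdiff_succ, fdiff_succ, fdiff_succ, ← ih]
    congr 1
    funext m
    abel

/-- `Δ^k 0 = 0`. -/
theorem fdiff_zero_fun (k : ℕ) : ∀ n : ℕ, fdiff k (fun _ ↦ (0 : G)) n = 0 := by
  induction k with
  | zero => intro n; rfl
  | succ k ih =>
    intro n
    rw [fdiff_succ]
    simp only [sub_zero]
    exact ih n

/-- differences of order `≥ 1` kill constants -/
theorem fdiff_const (k : ℕ) (c : G) (n : ℕ) : fdiff (k + 1) (fun _ ↦ c) n = 0 := by
  rw [fdiff_succ]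
  simp only [sub_self]
  exact fdiff_zero_fun k n

/-- `Δ^k` commutes with finite sums. -/
theorem fdiff_sum {ι : Type*} (s : Finset ι) (k : ℕ) : ∀ (F : ι → ℕ → G) (n : ℕ),
    fdiff k (fun m ↦ ∑ i ∈ s, F i m) n = ∑ i ∈ s, fdiff k (F i) n := by
  induction k with
  | zero => intro F n; rfl
  | succ k ih =>
    intro F n
    rw [fdiff_succ]
    have e : (fun m ↦ ∑ i ∈ s, F i (m + 1) - ∑ i ∈ s, F i m) = fun m ↦ ∑ i ∈ s, (F i (m + 1) - F i m) := by
      funext m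
      rw [Finset.sum_sub_distrib]
    rw [e, ih (fun i m ↦ F i (m + 1) - F i m) n]
    rfl

/-- `fdiff k` is Mathlib's iterated forward difference `(fwdDiff 1)^[k]` = `Δ_[1]^[k]` (kept here as a
structural recursion so that `fdiff (k+1) f n` unfolds definitionally; a typer may restate through `fwdDiff`). -/
theorem fdiff_eq_fwdDiff_iter (k : ℕ) : ∀ f : ℕ → G, fdiff k f = (fwdDiff 1)^[k] f := by
  induction k with
  | zero => intro f; rfl
  | succ k ih =>
    intro f
    rw [Function.iterate_succ_apply, ← ih]
    rfl

/-- shifting the sequence shifts the differences -/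
theorem fdiff_shift (k : ℕ) : ∀ (f : ℕ → G) (n : ℕ), fdiff k (fun m ↦ f (m + 1)) n = fdiff k f (n + 1) := by
  induction k with
  | zero => intro f n; rfl
  | succ k ih => intro f n; exact ih (fun m ↦ f (m + 1) - f m) n

end FdiffAlgebra

/-- `Δ^k (c · f) = c · Δ^k f` over a commutative ring. -/
theorem fdiff_const_mul {R : Type*} [CommRing R] (k : ℕ) : ∀ (c : R) (f : ℕ → R) (n : ℕ),
    fdiff k (fun m ↦ c * f m) n = c * fdiff k f n := by
  induction k with
  | zero => intro c f n; rfl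
  | succ k ih =>
    intro c f n
    rw [fdiff_succ, fdiff_succ, ← ih]
    congr 1
    funext m
    ring

/-- `Δ^k (c uⁿ) = c (u−1)^k uⁿ` -/
theorem fdiff_geom {R : Type*} [CommRing R] (u : R) (k : ℕ) : ∀ (c : R) (n : ℕ),
    fdiff k (fun m ↦ c * u ^ m) n = c * (u - 1) ^ k * u ^ n := by
  induction k with
  | zero => intro c n; simp [fdiff]
  | succ k ih =>
    intro c n
    rw [fdiff_succ]
    have e : (fun m ↦ c * u ^ (m + 1) - c * u ^ m) = fun m ↦ (c * (u - 1)) * u ^ m := by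
      funext m
      ring
    rw [e, ih]
    ring

/-- `Δ^k C(n, k) = 1` (Pascal) — the tilt polynomial of the ¬RH branch -/
theorem fdiff_choose : ∀ (k n : ℕ), fdiff k (fun m ↦ (m.choose k : ℝ)) n = 1 := by
  intro k
  induction k with
  | zero => intro n; simp [fdiff]
  | succ k ih =>
    intro n
    rw [fdiff_succ, ← ih n]
    congr 1
    funext m
    simp only [Nat.choose_succ_succ', Nat.cast_add]
    ring

/-- `Δ² f` is the curvature sequence of §§2–4 -/
theorem fdiff_two_real (f : ℕ → ℝ) (n : ℕ) : fdiff 2 f n = f (n + 2) - 2 * f (n + 1) + f n := by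
  show f (n + 1 + 1) - f (n + 1) - (f (n + 1) - f n) = _
  rw [show n + 1 + 1 = n + 2 from rfl]
  ring

/-- The real part commutes with `Δ^k`. -/
theorem re_fdiff (k : ℕ) : ∀ (F : ℕ → ℂ) (n : ℕ), (fdiff k F n).re = fdiff k (fun m ↦ (F m).re) n := by
  induction k with
  | zero => intro F n; rfl
  | succ k ih =>
    intro F n
    rw [fdiff_succ, fdiff_succ, ih]
    rfl

/-- `Δ^k` commutes with the coercion `ℝ → ℂ`. -/
theorem fdiff_ofReal (k : ℕ) : ∀ (f : ℕ → ℝ) (n : ℕ), fdiff k (fun m ↦ (f m : ℂ)) n = ((fdiff k f n : ℝ) : ℂ) := by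
  induction k with
  | zero => intro f n; rfl
  | succ k ih =>
    intro f n
    rw [fdiff_succ, fdiff_succ, ← ih]
    congr 1
    funext m
    exact (Complex.ofReal_sub _ _).symm

/-- differences of pointwise limits are limits of differences (finitely many indices involved) -/
theorem tendsto_fdiff (k : ℕ) : ∀ (F : ℝ → ℕ → ℂ) (g : ℕ → ℂ),
    (∀ n, Tendsto (fun T ↦ F T n) atTop (𝓝 (g n))) →
      ∀ n, Tendsto (fun T ↦ fdiff k (F T) n) atTop (𝓝 (fdiff k g n)) := by
  induction k with
  | zero => intro F g h n; exact h n
  | succ k ih =>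
    intro F g h n
    exact ih (fun T m ↦ F T (m + 1) - F T m) (fun m ↦ g (m + 1) - g m) (fun m ↦ (h (m + 1)).sub (h m)) n

/-! ### §5a ¬RH: every order `k+1 ≥ 1` is two-signed with any margin in late windows (discrete Rolle) -/

/-- **Discrete Rolle / Descartes.** An alternating sign pattern of length `k+2` along `p 0 < p 1 < ⋯ < p (k+1)`
(sign `(−1)^{j+k}` at `p j`) is incompatible with `Δ^{k+1} f ≥ 0` on `[p 0, p (k+1) − (k+1)]`. -/
theorem no_alternating_of_fdiff_nonneg : ∀ (k : ℕ) (f : ℕ → ℝ) (p : ℕ → ℕ),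
    (∀ j, j ≤ k → p j < p (j + 1)) →
    (∀ j, j ≤ k + 1 → 0 < (-1 : ℝ) ^ (j + k) * f (p j)) →
    (∀ n, p 0 ≤ n → n + (k + 1) ≤ p (k + 1) → 0 ≤ fdiff (k + 1) f n) → False := by
  intro k
  induction k with
  | zero =>
    intro f p hp hsign hdiff
    have h0 : 0 < (-1 : ℝ) ^ (0 + 0) * f (p 0) := hsign 0 (by omega)
    have h1 : 0 < (-1 : ℝ) ^ (1 + 0) * f (p 1) := hsign 1 (by omega)
    norm_num at h0 h1
    have hp01 : p 0 < p 1 := hp 0 le_rfl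
    obtain ⟨d, hd⟩ := Nat.exists_eq_add_of_lt hp01
    have hmono := le_of_forall_incr (f := f) (p 0) (d + 1) fun n hn1 hn2 ↦ by
      have : 0 ≤ f (n + 1) - f n := hdiff n hn1 (show n + 1 ≤ p 1 by omega)
      linarith
    rw [show p 0 + (d + 1) = p 1 by omega] at hmono
    linarith
  | succ k ih =>
    intro f p hp hsign hdiff
    have hex : ∀ j, ∃ a, j ≤ k + 1 →
        (p j ≤ a ∧ a < p (j + 1) ∧ 0 < (-1 : ℝ) ^ (j + k) * (f (a + 1) - f a)) := by
      intro j
      by_cases hj : j ≤ k + 1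
      · suffices h : ∃ a, p j ≤ a ∧ a < p (j + 1) ∧ 0 < (-1 : ℝ) ^ (j + k) * (f (a + 1) - f a) by
          obtain ⟨a, ha⟩ := h
          exact ⟨a, fun _ ↦ ha⟩
        have hs1 : 0 < (-1 : ℝ) ^ (j + 1 + (k + 1)) * f (p (j + 1)) := hsign (j + 1) (by omega)
        have hs0 : 0 < (-1 : ℝ) ^ (j + (k + 1)) * f (p j) := hsign j (by omega)
        have e1 : (-1 : ℝ) ^ (j + 1 + (k + 1)) = (-1) ^ (j + k) := by
          rw [show j + 1 + (k + 1) = j + k + 2 by omega, pow_add, neg_one_sq, mul_one]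
        have e0 : (-1 : ℝ) ^ (j + (k + 1)) = -(-1) ^ (j + k) := by
          rw [show j + (k + 1) = j + k + 1 by omega, pow_succ, mul_neg_one]
        rw [e1] at hs1
        rw [e0, neg_mul] at hs0
        by_contra hno
        push Not at hno
        obtain ⟨d, hd⟩ := Nat.exists_eq_add_of_lt (hp j (by omega))
        have hmono := le_of_forall_incr (f := fun n ↦ -((-1 : ℝ) ^ (j + k) * f n)) (p j) (d + 1)
          fun n hn1 hn2 ↦ by
            have := hno n hn1 (by omega)
            show -((-1 : ℝ) ^ (j + k) * f n) ≤ -((-1) ^ (j + k) * f (n + 1))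
            have e : (-1 : ℝ) ^ (j + k) * (f (n + 1) - f n)
                = (-1) ^ (j + k) * f (n + 1) - (-1) ^ (j + k) * f n := mul_sub _ _ _
            linarith
        rw [show p j + (d + 1) = p (j + 1) by omega] at hmono
        linarith
      · exact ⟨0, fun h ↦ absurd h hj⟩
    choose a ha using hex
    refine ih (fun n ↦ f (n + 1) - f n) a (fun j hj ↦ ?_) (fun j hj ↦ (ha j (by omega)).2.2)
      (fun n hn1 hn2 ↦ ?_)
    · have h1 := (ha j (by omega)).2.1
      have h2 := (ha (j + 1) (by omega)).1
      omega
    · have h1 := (ha 0 (by omega)).1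
      have h2 := (ha (k + 1) le_rfl).2.1
      exact hdiff n (by omega) (by omega)

/-- Polynomial versus exponential, degree `d`: `η n^d < c·r₀^{-n}` for all large `n`. -/
theorem eventually_pow_lt_pow {r₀ c η : ℝ} (hr₀0 : 0 < r₀) (hr₀1 : r₀ < 1) (hc : 0 < c) (hη : 0 ≤ η) (d : ℕ) :
    ∃ n₂ : ℕ, ∀ n : ℕ, n₂ ≤ n → η * (n : ℝ) ^ d < c * r₀⁻¹ ^ n := by
  have ht : Tendsto (fun n : ℕ ↦ (n : ℝ) ^ d * r₀ ^ n) atTop (𝓝 0) :=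
    tendsto_pow_const_mul_const_pow_of_abs_lt_one d (by rw [abs_of_pos hr₀0]; exact hr₀1)
  obtain ⟨n₂, hn₂⟩ := Metric.tendsto_atTop.1 ht (c / (η + 1)) (by positivity)
  refine ⟨n₂, fun n hn ↦ ?_⟩
  have h := hn₂ n hn
  rw [Real.dist_0_eq_abs, abs_of_nonneg (by positivity), lt_div_iff₀ (by positivity)] at h
  have hpow : r₀ ^ n * r₀⁻¹ ^ n = 1 := by rw [← mul_pow, mul_inv_cancel₀ hr₀0.ne', one_pow]
  have hpos : 0 < r₀⁻¹ ^ n := pow_pos (inv_pos.2 hr₀0) n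
  have hX : 0 ≤ (n : ℝ) ^ d * r₀ ^ n := by positivity
  calc η * (n : ℝ) ^ d = η * (n : ℝ) ^ d * (r₀ ^ n * r₀⁻¹ ^ n) := by rw [hpow, mul_one]
    _ = (η * ((n : ℝ) ^ d * r₀ ^ n)) * r₀⁻¹ ^ n := by ring
    _ ≤ ((η + 1) * ((n : ℝ) ^ d * r₀ ^ n)) * r₀⁻¹ ^ n := by
        refine mul_le_mul_of_nonneg_right ?_ hpos.le
        exact mul_le_mul_of_nonneg_right (by linarith) hX
    _ < c * r₀⁻¹ ^ n := by
        refine mul_lt_mul_of_pos_right ?_ hpos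
        rw [mul_comm] at h
        exact h

/-- **¬RH branch, every order ≥ 1.** If RH fails then for every `k` and every margin `η ≥ 0` there are
`L`, `n₁` such that every window `[a, a+L)`, `a ≥ n₁`, contains `n`, `n'` with `Δ^{k+1}λ_n < −η`,
`Δ^{k+1}λ_{n'} > η`. -/
theorem liFdiff_two_signs_of_not_rh (hRH : ¬ RiemannHypothesis) (k : ℕ) {η : ℝ} (hη : 0 ≤ η) :
    ∃ L n₁ : ℕ, ∀ a : ℕ, n₁ ≤ a →
      (∃ n ∈ Ico a (a + L), fdiff (k + 1) keiperLiCoeff n < -η) ∧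
      (∃ n ∈ Ico a (a + L), η < fdiff (k + 1) keiperLiCoeff n) := by
  obtain ⟨r₀, hr₀0, hr₀1, -, -, c, hc, -, L, n₁, -, hwin⟩ := li_two_signs_of_not_rh hRH
  obtain ⟨n₂, hn₂⟩ := eventually_pow_lt_pow hr₀0 hr₀1 hc hη (k + 1)
  have hchoose : ∀ n : ℕ, n₂ ≤ n → η * (n.choose (k + 1) : ℝ) < c * r₀⁻¹ ^ n := fun n hn ↦ by
    refine lt_of_le_of_lt ?_ (hn₂ n hn)
    gcongr
    exact_mod_cast Nat.choose_le_pow n (k + 1)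
  have hpos : ∀ n : ℕ, 0 < c * r₀⁻¹ ^ n := fun n ↦ mul_pos hc (pow_pos (inv_pos.2 hr₀0) n)
  have hpick : ∀ N, n₁ ≤ N → ∀ ε : ℝ, (ε = 1 ∨ ε = -1) →
      ∃ p ∈ Ico N (N + L), c * r₀⁻¹ ^ p ≤ ε * keiperLiCoeff p := by
    intro N hN ε hε
    rcases hε with rfl | rfl
    · obtain ⟨p, hp, h⟩ := (hwin N hN).1
      exact ⟨p, hp, by linarith⟩
    · obtain ⟨p, hp, h⟩ := (hwin N hN).2
      exact ⟨p, hp, by linarith⟩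
  have hpm : ∀ j : ℕ, (-1 : ℝ) ^ (j + k) = 1 ∨ (-1 : ℝ) ^ (j + k) = -1 := fun j ↦ neg_one_pow_eq_or ℝ (j + k)
  have hpm' : ∀ j : ℕ, -(-1 : ℝ) ^ (j + k) = 1 ∨ -(-1 : ℝ) ^ (j + k) = -1 := fun j ↦ by
    rcases hpm j with h | h <;> rw [h] <;> norm_num
  -- pattern builder: signs ε j = ±1 prescribed, points p j in the consecutive windows
  have hpat : ∀ a : ℕ, n₁ ≤ a → ∀ ε : ℕ → ℝ, (∀ j, ε j = 1 ∨ ε j = -1) →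
      ∃ p : ℕ → ℕ, ∀ j, j ≤ k + 1 →
        p j ∈ Ico (a + j * L) (a + j * L + L) ∧ c * r₀⁻¹ ^ p j ≤ ε j * keiperLiCoeff (p j) := by
    intro a ha ε hε
    have hex : ∀ j, ∃ p, j ≤ k + 1 →
        (p ∈ Ico (a + j * L) (a + j * L + L) ∧ c * r₀⁻¹ ^ p ≤ ε j * keiperLiCoeff p) := by
      intro j
      obtain ⟨p, hp, h⟩ := hpick (a + j * L) (by omega) (ε j) (hε j)
      exact ⟨p, fun _ ↦ ⟨hp, h⟩⟩
    choose p hp using hex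
    exact ⟨p, hp⟩
  refine ⟨(k + 2) * L, max n₁ n₂, fun a ha ↦ ?_⟩
  have ha1 : n₁ ≤ a := le_of_max_le_left ha
  have ha2 : n₂ ≤ a := le_of_max_le_right ha
  have hgeom : ∀ {p : ℕ → ℕ}, (∀ j, j ≤ k + 1 → p j ∈ Ico (a + j * L) (a + j * L + L)) →
      (∀ j, j ≤ k → p j < p (j + 1)) ∧ a ≤ p 0 ∧ p (k + 1) < a + (k + 2) * L ∧
        ∀ j, j ≤ k + 1 → n₂ ≤ p j := by
    intro p hp
    refine ⟨fun j hj ↦ ?_, ?_, ?_, fun j hj ↦ ?_⟩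
    · have h1 := (Finset.mem_Ico.1 (hp j (by omega))).2
      have h2 := (Finset.mem_Ico.1 (hp (j + 1) (by omega))).1
      have e : a + j * L + L = a + (j + 1) * L := by ring
      omega
    · have := (Finset.mem_Ico.1 (hp 0 (by omega))).1
      omega
    · have := (Finset.mem_Ico.1 (hp (k + 1) le_rfl)).2
      have e : a + (k + 1) * L + L = a + (k + 2) * L := by ring
      omega
    · have := (Finset.mem_Ico.1 (hp j hj)).1
      omega
  constructor
  · by_contra hno
    push Not at hno
    obtain ⟨p, hp⟩ := hpat a ha1 (fun j ↦ (-1) ^ (j + k)) hpm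
    obtain ⟨hmono, h0, hK, hn2⟩ := hgeom fun j hj ↦ (hp j hj).1
    refine no_alternating_of_fdiff_nonneg k (fun n ↦ keiperLiCoeff n + η * (n.choose (k + 1) : ℝ)) p
      hmono (fun j hj ↦ ?_) (fun n hn1 hn2' ↦ ?_)
    · have hcj := (hp j hj).2
      have hηC : 0 ≤ η * ((p j).choose (k + 1) : ℝ) := by positivity
      rcases hpm j with hs | hs
      · rw [hs] at hcj ⊢
        linarith [hpos (p j)]
      · rw [hs] at hcj ⊢
        have := hchoose (p j) (hn2 j hj)
        linarith
    · rw [fdiff_add, fdiff_const_mul, fdiff_choose, mul_one]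
      have := hno n (Finset.mem_Ico.2 ⟨by omega, by omega⟩)
      linarith
  · by_contra hno
    push Not at hno
    obtain ⟨p, hp⟩ := hpat a ha1 (fun j ↦ -(-1) ^ (j + k)) hpm'
    obtain ⟨hmono, h0, hK, hn2⟩ := hgeom fun j hj ↦ (hp j hj).1
    refine no_alternating_of_fdiff_nonneg k
      (fun n ↦ (-1) * keiperLiCoeff n + η * (n.choose (k + 1) : ℝ)) p hmono (fun j hj ↦ ?_)
      (fun n hn1 hn2' ↦ ?_)
    · have hcj := (hp j hj).2
      have hηC : 0 ≤ η * ((p j).choose (k + 1) : ℝ) := by positivity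
      rcases hpm j with hs | hs
      · rw [hs] at hcj ⊢
        linarith [hpos (p j)]
      · rw [hs] at hcj ⊢
        have := hchoose (p j) (hn2 j hj)
        linarith
    · rw [fdiff_add, fdiff_const_mul, fdiff_const_mul, fdiff_choose, mul_one]
      have := hno n (Finset.mem_Ico.2 ⟨by omega, by omega⟩)
      linarith

end Summit.RiemannHypothesis.RiemannHypothesis.Theorems.Splittings.LiDifferenceOrderLaw

end
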